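/-
Origin: expansion seat `planner-pub-hodgecm-pv02-g3-0`, handover #10 2026-08-18T06:20:45Z (`HOME/pub-hodgecm-pv02-g3/lean/Pv02g3/PerL34/PartialFractions.lean`, md5 cb77ec35, 114 lines);
landed by the gen-6 packager in gate run 24 as `HodgeCM/PerL34/PartialFractions.lean` (stripped 1 #print/#check/#eval lines).
-/
/-
Origin: planner-pub-hodgecm-pv02-g3-0 (unit pub-hodgecm-pv02-g3, DAG-NODE PROVER #02 gen 3), 2026-08-18.
Proposed tree path: `HodgeCM/PerL34/PartialFractions.lean` (new, additive, Mathlib-only).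
KERNEL: nothing cited, nothing asserted.
-/
import Mathlib.Algebra.Polynomial.FieldDivision
import Mathlib.Algebra.Polynomial.Roots
import Mathlib.RingTheory.Coprime.Lemmas
import Mathlib.Analysis.Complex.Basic

/-!
# Partial-fraction uniqueness with double poles (the algebraic core of `SplitHolForms.OrbitSpansDisjoint`)

`pf_unique`: if `p₀(t) + ∑_{r ∈ I} p_r(t)/(t − r)² = 0` for infinitely many `t` (none of them in the finite pole set
`I ⊂ ℂ`), with `deg p_r ≤ 1`, then `p₀ = 0` and every `p_r = 0`.

Use (see `HOME/pub-hodgecm-pv02-g3/HANDOFF.md`): restrict an identity `∑_c Q_c/ℓ_c² = 0` between the two orbit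
families to a generic complex line `t ↦ (t, m t)`; the affine `ℓ_c` become `a_c (t − r_c)` with distinct `r_c` (and at
most one constant class, absorbed in `p₀`), the affine numerators become the `p_r`.
-/

noncomputable section

open Polynomial Finset

namespace HodgeCM
namespace PerL34
namespace PartialFractions

/-- The common denominator `D = ∏_{r ∈ I} (X − r)²`. -/
def D (I : Finset ℂ) : ℂ[X] := ∏ r ∈ I, (X - C r) ^ 2

/-- (Ported verbatim from the HodgeCMPerL package; no docstring in the source.) -/
theorem D_monic (I : Finset ℂ) : (D I).Monic :=
  monic_prod_of_monic _ _ fun r _ => (monic_X_sub_C r).pow 2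

/-- (Ported verbatim from the HodgeCMPerL package; no docstring in the source.) -/
theorem D_ne_zero (I : Finset ℂ) : D I ≠ 0 := (D_monic I).ne_zero

/-- (Ported verbatim from the HodgeCMPerL package; no docstring in the source.) -/
theorem eval_D (I : Finset ℂ) (t : ℂ) : (D I).eval t = ∏ r ∈ I, (t - r) ^ 2 := by
  simp [D, eval_prod]

/-- The cleared numerator `P = p₀ D + ∑_r p_r ∏_{j ≠ r} (X − j)²`. -/
def P (I : Finset ℂ) (p : ℂ → ℂ[X]) (p₀ : ℂ[X]) : ℂ[X] :=
  p₀ * D I + ∑ r ∈ I, p r * ∏ j ∈ I.erase r, (X - C j) ^ 2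

/-- (Ported verbatim from the HodgeCMPerL package; no docstring in the source.) -/
theorem eval_P (I : Finset ℂ) (p : ℂ → ℂ[X]) (p₀ : ℂ[X]) {t : ℂ} (ht : t ∉ I) :
    (P I p p₀).eval t = (D I).eval t * (p₀.eval t + ∑ r ∈ I, (p r).eval t / (t - r) ^ 2) := by
  have hne : ∀ r ∈ I, (t - r) ^ 2 ≠ 0 := fun r hr => pow_ne_zero _ (sub_ne_zero.mpr (by rintro rfl; exact ht hr))
  have herase : ∀ r ∈ I, ∏ j ∈ I.erase r, (t - j) ^ 2 = (∏ j ∈ I, (t - j) ^ 2) / (t - r) ^ 2 := by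
    intro r hr
    rw [eq_div_iff (hne r hr), mul_comm, Finset.mul_prod_erase I (fun j => (t - j) ^ 2) hr]
  simp only [P, eval_add, eval_mul, eval_finsetSum, eval_prod, eval_pow, eval_sub, eval_X, eval_C, eval_D]
  rw [mul_add, Finset.mul_sum]
  congr 1
  · ring
  · refine Finset.sum_congr rfl fun r hr => ?_
    rw [herase r hr]
    field_simp

/-- If the rational identity holds on an infinite set avoiding the poles, the cleared numerator vanishes. -/
theorem P_eq_zero (I : Finset ℂ) (p : ℂ → ℂ[X]) (p₀ : ℂ[X]) {S : Set ℂ} (hS : S.Infinite)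
    (hSI : ∀ t ∈ S, t ∉ I) (h : ∀ t ∈ S, p₀.eval t + ∑ r ∈ I, (p r).eval t / (t - r) ^ 2 = 0) :
    P I p p₀ = 0 := by
  refine Polynomial.eq_zero_of_infinite_isRoot _ (hS.mono ?_)
  intro t ht
  simp only [Set.mem_setOf_eq, IsRoot.def, eval_P I p p₀ (hSI t ht), h t ht, mul_zero]

/-- Each double-pole factor divides the corresponding numerator term once `P = 0`. -/
theorem dvd_term (I : Finset ℂ) (p : ℂ → ℂ[X]) (p₀ : ℂ[X]) (hP : P I p p₀ = 0) {r : ℂ} (hr : r ∈ I) :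
    (X - C r) ^ 2 ∣ p r * ∏ j ∈ I.erase r, (X - C j) ^ 2 := by
  have hD : (X - C r) ^ 2 ∣ D I := Finset.dvd_prod_of_mem (fun j => (X - C j) ^ 2) hr
  have hother : ∀ k ∈ I.erase r, (X - C r) ^ 2 ∣ p k * ∏ j ∈ I.erase k, (X - C j) ^ 2 := by
    intro k hk
    refine Dvd.dvd.mul_left (Finset.dvd_prod_of_mem (fun j => (X - C j) ^ 2) ?_) _
    exact Finset.mem_erase.mpr ⟨(Finset.mem_erase.mp hk).1.symm, hr⟩
  have hsplit : p r * ∏ j ∈ I.erase r, (X - C j) ^ 2 =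
      -(p₀ * D I + ∑ k ∈ I.erase r, p k * ∏ j ∈ I.erase k, (X - C j) ^ 2) := by
    have := hP
    rw [P, ← Finset.add_sum_erase I _ hr] at this
    linear_combination this
  rw [hsplit]
  exact (Dvd.dvd.mul_left hD _ |>.add (Finset.dvd_sum hother)).neg_right

/-- (Ported verbatim from the HodgeCMPerL package; no docstring in the source.) -/
theorem coprime_term (I : Finset ℂ) {r : ℂ} :
    IsCoprime ((X - C r) ^ 2) (∏ j ∈ I.erase r, (X - C j) ^ 2) := by
  refine IsCoprime.prod_right fun j hj => ?_
  have hne : r ≠ j := (Finset.mem_erase.mp hj).1.symm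
  exact ((Polynomial.isCoprime_X_sub_C_of_isUnit_sub (sub_ne_zero.mpr hne).isUnit).pow)

/-- **Partial-fraction uniqueness.** -/
theorem pf_unique (I : Finset ℂ) (p : ℂ → ℂ[X]) (hp : ∀ r ∈ I, (p r).natDegree ≤ 1) (p₀ : ℂ[X])
    {S : Set ℂ} (hS : S.Infinite) (hSI : ∀ t ∈ S, t ∉ I)
    (h : ∀ t ∈ S, p₀.eval t + ∑ r ∈ I, (p r).eval t / (t - r) ^ 2 = 0) :
    p₀ = 0 ∧ ∀ r ∈ I, p r = 0 := by
  have hP := P_eq_zero I p p₀ hS hSI h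
  have hpr : ∀ r ∈ I, p r = 0 := by
    intro r hr
    have hdvd : (X - C r) ^ 2 ∣ p r := (coprime_term I).dvd_of_dvd_mul_right (dvd_term I p p₀ hP hr)
    refine Polynomial.eq_zero_of_dvd_of_natDegree_lt hdvd ?_
    rw [natDegree_pow, natDegree_X_sub_C]
    exact Nat.lt_of_le_of_lt (hp r hr) (by norm_num)
  refine ⟨?_, hpr⟩
  have h0 : p₀ * D I = 0 := by
    have := hP
    rw [P, Finset.sum_eq_zero (fun r hr => by rw [hpr r hr, zero_mul]), add_zero] at this
    exact this
  exact (mul_eq_zero.mp h0).resolve_right (D_ne_zero I)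

end PartialFractions
end PerL34
end HodgeCM

end

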